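import Mathlib

/-!
# `LaplaceOptimalFive`, slice class `a = 3`: transporting a three-slices/three-pairs decomposition to normal form
# (crux `RankRigidMinimalRepr`, stmt-ValiantsHypothesis-18034; frontier rung `LaplaceOptimalFive`, stmt-24813)

The normalisation behind the certificate tables (`…LaplaceFiveThreeSlicesCerts{A,B,C}.lean`,
`…LaplaceFiveThreeSlicesSorted.lean`).  A purported decomposition of the `5 × 5` permutation pattern into three slices
(slots `i : Fin 3 → Fin 5`, any multiplicities; vectors `α_k`, cofactors `W_k` blind to slot `i k`) and three pair
terms (cuts `{p t, q t}`; `u_t(v_{p t}, v_{q t})`, `w_t` blind to the two slots) is transported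

* by a SLOT RELABELLING `σ ∈ 𝔖₅` together with a re-indexing `π` of the slices (`three_slices_transport_slots`:
  `v ↦ v ∘ σ` keeps the pattern; slots `↦ σ ∘ i ∘ π`, cuts `↦ σ ∘ p, σ ∘ q`),
* by ORIENTING every cut (`three_slices_transport_flip`: `(p t, q t) ↦ (min, max)`; the identity is unchanged),
* by RE-INDEXING the pair terms (`three_slices_transport_pairs`, `ρ ∈ 𝔖₃`) and into the vector form of the tables
  (`three_slices_of_vector`),

so that refuting every SORTED configuration (oriented cuts with non-decreasing codes `5 p + q`) on a slot pattern `I`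
refutes every configuration whose slice slots are carried to `I` (`three_slices_reduce`; the permutations exist by
`perm_to_zero`, `perm_to_zero_one`, `perm_to_zero_one_two`, the sorting by `sort_three`).  Statements are written out
(no definition of «refuted»): each transport lemma takes the refutation of the transported configurations as a
hypothesis and concludes the refutation of the original one.

No new definitions.  HONEST FRAMING: bookkeeping toward the frontier rung `LaplaceOptimalFive` (stmt-24813), which
stays OPEN; nothing here bears on `VP ≠ VNP`.
-/

set_option autoImplicit false

-- the mandated summit-side namespace repeats a component by design (single-problem summit)
set_option linter.dupNamespace false

namespace Summit.ValiantsHypothesis.ValiantsHypothesis.Theorems.RigidityForcesSymmetryRankRigidMinimalRepr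

namespace LaplaceFiveSlices

open Finset

/-! ### §1 Small combinatorial facts -/

/-- A permutation of `Fin 5` sending three distinct slots to `0, 1, 2`. -/
theorem perm_to_zero_one_two : ∀ a b c : Fin 5, a ≠ b → a ≠ c → b ≠ c →
    ∃ σ : Equiv.Perm (Fin 5), σ a = 0 ∧ σ b = 1 ∧ σ c = 2 := by
  decide +kernel

/-- A permutation of `Fin 5` sending two distinct slots to `0, 1`. -/
theorem perm_to_zero_one : ∀ a b : Fin 5, a ≠ b → ∃ σ : Equiv.Perm (Fin 5), σ a = 0 ∧ σ b = 1 := by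
  decide +kernel

/-- A permutation of `Fin 5` sending a slot to `0`. -/
theorem perm_to_zero : ∀ a : Fin 5, ∃ σ : Equiv.Perm (Fin 5), σ a = 0 := by
  decide +kernel

/-- Sorting three numbers by a permutation of the indices. -/
theorem sort_three (f : Fin 3 → ℕ) : ∃ ρ : Equiv.Perm (Fin 3), f (ρ 0) ≤ f (ρ 1) ∧ f (ρ 1) ≤ f (ρ 2) := by
  rcases le_total (f 0) (f 1) with h01 | h10 <;> rcases le_total (f 1) (f 2) with h12 | h21 <;>
    rcases le_total (f 0) (f 2) with h02 | h20
  · exact ⟨1, by simpa using h01, by simpa using h12⟩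
  · exact ⟨1, by simpa using h01, by simpa using h12⟩
  · -- order 0, 2, 1
    exact ⟨⟨![0, 2, 1], ![0, 2, 1], by decide, by decide⟩, h02, h21⟩
  · -- order 2, 0, 1
    exact ⟨⟨![2, 0, 1], ![1, 2, 0], by decide, by decide⟩, h20, h01⟩
  · -- order 1, 0, 2
    exact ⟨⟨![1, 0, 2], ![1, 0, 2], by decide, by decide⟩, h10, h02⟩
  · -- order 1, 2, 0
    exact ⟨⟨![1, 2, 0], ![2, 0, 1], by decide, by decide⟩, h12, h20⟩
  · -- order 2, 1, 0
    exact ⟨⟨![2, 1, 0], ![2, 1, 0], by decide, by decide⟩, h21, h10⟩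
  · -- order 2, 1, 0
    exact ⟨⟨![2, 1, 0], ![2, 1, 0], by decide, by decide⟩, h21, h10⟩

/-! ### §2 Transport of a three-slices/three-pairs decomposition -/

/-- **Slot relabelling and slice re-indexing.**  If every decomposition with slices at `I = σ ∘ i ∘ π` and cuts
`(σ (p t), σ (q t))` is impossible, so is every decomposition with slices at `i` and cuts `(p t, q t)`
(`v ↦ v ∘ σ` preserves the pattern). -/
theorem three_slices_transport_slots (σ : Equiv.Perm (Fin 5)) (π : Equiv.Perm (Fin 3)) (i I : Fin 3 → Fin 5)
    (hI : ∀ k, σ (i (π k)) = I k) (p q : Fin 3 → Fin 5)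
    (href :
      ∀ (α : Fin 3 → Fin 5 → ℂ) (W : Fin 3 → (Fin 5 → Fin 5) → ℂ),
        (∀ k, ∀ v v' : Fin 5 → Fin 5, (∀ j, j ≠ I k → v j = v' j) → W k v = W k v') →
        ∀ (u w : Fin 3 → (Fin 5 → Fin 5) → ℂ),
        (∀ t, ∀ v v' : Fin 5 → Fin 5,
            v (σ (p t)) = v' (σ (p t)) →
            v (σ (q t)) = v' (σ (q t)) → u t v = u t v') →
        (∀ t, ∀ v v' : Fin 5 → Fin 5,
            (∀ j, j ≠ σ (p t) → j ≠ σ (q t) → v j = v' j) → w t v = w t v') →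
        ¬ ∀ v : Fin 5 → Fin 5, (if Function.Injective v then (1 : ℂ) else 0) =
            (∑ k, α k (v (I k)) * W k v) + ∑ t, u t v * w t v)
    (α : Fin 3 → Fin 5 → ℂ) (W : Fin 3 → (Fin 5 → Fin 5) → ℂ)
    (hW : ∀ k, ∀ v v' : Fin 5 → Fin 5, (∀ j, j ≠ i k → v j = v' j) → W k v = W k v')
    (u w : Fin 3 → (Fin 5 → Fin 5) → ℂ)
    (hu : ∀ t, ∀ v v' : Fin 5 → Fin 5,
      v (p t) = v' (p t) → v (q t) = v' (q t) → u t v = u t v')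
    (hw : ∀ t, ∀ v v' : Fin 5 → Fin 5,
      (∀ j, j ≠ p t → j ≠ q t → v j = v' j) → w t v = w t v') :
    ¬ ∀ v : Fin 5 → Fin 5, (if Function.Injective v then (1 : ℂ) else 0) =
        (∑ k, α k (v (i k)) * W k v) + ∑ t, u t v * w t v := by
  intro H
  have hinj : ∀ v : Fin 5 → Fin 5, Function.Injective (v ∘ σ) ↔ Function.Injective v := fun v =>
    ⟨fun h => by simpa [Function.comp_assoc] using h.comp σ.symm.injective, fun h => h.comp σ.injective⟩
  refine href (fun k => α (π k)) (fun k v => W (π k) (v ∘ σ)) ?_ (fun t v => u t (v ∘ σ)) (fun t v => w t (v ∘ σ))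
    ?_ ?_ ?_
  · intro k v v' hvv'
    refine hW (π k) _ _ (fun j hj => ?_)
    simp only [Function.comp_apply]
    exact hvv' (σ j) (fun h => hj (σ.injective (h.trans (hI k).symm)))
  · intro t v v' h1 h2
    exact hu t _ _ (by simpa using h1) (by simpa using h2)
  · intro t v v' hvv'
    refine hw t _ _ (fun j hjp hjq => ?_)
    simp only [Function.comp_apply]
    exact hvv' (σ j) (fun h => hjp (σ.injective h)) (fun h => hjq (σ.injective h))
  · intro v
    have hif : (if Function.Injective (v ∘ σ) then (1 : ℂ) else 0) = if Function.Injective v then 1 else 0 := by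
      by_cases hv : Function.Injective v
      · rw [if_pos hv, if_pos ((hinj v).mpr hv)]
      · rw [if_neg hv, if_neg (fun h => hv ((hinj v).mp h))]
    rw [← hif, H (v ∘ σ)]
    congr 1
    rw [← Equiv.sum_comp π]
    refine Fintype.sum_congr _ _ (fun k => ?_)
    simp only [Function.comp_apply, hI]

/-- **Orientation.**  The pair hypotheses are symmetric in the two slots of a cut, so the cuts may be oriented
`(min, max)`; the identity is unchanged. -/
theorem three_slices_transport_flip (I P Q : Fin 3 → Fin 5)
    (href :
      ∀ (α : Fin 3 → Fin 5 → ℂ) (W : Fin 3 → (Fin 5 → Fin 5) → ℂ),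
        (∀ k, ∀ v v' : Fin 5 → Fin 5, (∀ j, j ≠ I k → v j = v' j) → W k v = W k v') →
        ∀ (u w : Fin 3 → (Fin 5 → Fin 5) → ℂ),
        (∀ t, ∀ v v' : Fin 5 → Fin 5,
            v (min (P t) (Q t)) = v' (min (P t) (Q t)) →
            v (max (P t) (Q t)) = v' (max (P t) (Q t)) → u t v = u t v') →
        (∀ t, ∀ v v' : Fin 5 → Fin 5,
            (∀ j, j ≠ min (P t) (Q t) → j ≠ max (P t) (Q t) → v j = v' j) → w t v = w t v') →
        ¬ ∀ v : Fin 5 → Fin 5, (if Function.Injective v then (1 : ℂ) else 0) =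
            (∑ k, α k (v (I k)) * W k v) + ∑ t, u t v * w t v)
    (α : Fin 3 → Fin 5 → ℂ) (W : Fin 3 → (Fin 5 → Fin 5) → ℂ)
    (hW : ∀ k, ∀ v v' : Fin 5 → Fin 5, (∀ j, j ≠ I k → v j = v' j) → W k v = W k v')
    (u w : Fin 3 → (Fin 5 → Fin 5) → ℂ)
    (hu : ∀ t, ∀ v v' : Fin 5 → Fin 5,
      v (P t) = v' (P t) → v (Q t) = v' (Q t) → u t v = u t v')
    (hw : ∀ t, ∀ v v' : Fin 5 → Fin 5,
      (∀ j, j ≠ P t → j ≠ Q t → v j = v' j) → w t v = w t v') :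
    ¬ ∀ v : Fin 5 → Fin 5, (if Function.Injective v then (1 : ℂ) else 0) =
        (∑ k, α k (v (I k)) * W k v) + ∑ t, u t v * w t v := by
  refine href α W hW u w ?_ ?_
  · intro t v v' h1 h2
    rcases le_total (P t) (Q t) with h | h
    · rw [min_eq_left h, max_eq_right h] at *; exact hu t v v' h1 h2
    · rw [min_eq_right h, max_eq_left h] at *; exact hu t v v' h2 h1
  · intro t v v' hvv'
    refine hw t v v' (fun j hjp hjq => ?_)
    rcases le_total (P t) (Q t) with h | h
    · exact hvv' j (by rwa [min_eq_left h]) (by rwa [max_eq_right h])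
    · exact hvv' j (by rwa [min_eq_right h]) (by rwa [max_eq_left h])

/-- **Re-indexing the pair terms** by `ρ ∈ 𝔖₃`. -/
theorem three_slices_transport_pairs (ρ : Equiv.Perm (Fin 3)) (I P Q : Fin 3 → Fin 5)
    (href :
      ∀ (α : Fin 3 → Fin 5 → ℂ) (W : Fin 3 → (Fin 5 → Fin 5) → ℂ),
        (∀ k, ∀ v v' : Fin 5 → Fin 5, (∀ j, j ≠ I k → v j = v' j) → W k v = W k v') →
        ∀ (u w : Fin 3 → (Fin 5 → Fin 5) → ℂ),
        (∀ t, ∀ v v' : Fin 5 → Fin 5,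
            v (P (ρ t)) = v' (P (ρ t)) →
            v (Q (ρ t)) = v' (Q (ρ t)) → u t v = u t v') →
        (∀ t, ∀ v v' : Fin 5 → Fin 5,
            (∀ j, j ≠ P (ρ t) → j ≠ Q (ρ t) → v j = v' j) → w t v = w t v') →
        ¬ ∀ v : Fin 5 → Fin 5, (if Function.Injective v then (1 : ℂ) else 0) =
            (∑ k, α k (v (I k)) * W k v) + ∑ t, u t v * w t v)
    (α : Fin 3 → Fin 5 → ℂ) (W : Fin 3 → (Fin 5 → Fin 5) → ℂ)
    (hW : ∀ k, ∀ v v' : Fin 5 → Fin 5, (∀ j, j ≠ I k → v j = v' j) → W k v = W k v')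
    (u w : Fin 3 → (Fin 5 → Fin 5) → ℂ)
    (hu : ∀ t, ∀ v v' : Fin 5 → Fin 5,
      v (P t) = v' (P t) → v (Q t) = v' (Q t) → u t v = u t v')
    (hw : ∀ t, ∀ v v' : Fin 5 → Fin 5,
      (∀ j, j ≠ P t → j ≠ Q t → v j = v' j) → w t v = w t v') :
    ¬ ∀ v : Fin 5 → Fin 5, (if Function.Injective v then (1 : ℂ) else 0) =
        (∑ k, α k (v (I k)) * W k v) + ∑ t, u t v * w t v := by
  intro H
  refine href α W hW (fun t => u (ρ t)) (fun t => w (ρ t)) (fun t => hu (ρ t)) (fun t => hw (ρ t)) (fun v => ?_)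
  rw [H v]
  congr 1
  exact (Equiv.sum_comp ρ (fun t => u t v * w t v)).symm

/-- **Vector form** of the cuts (`![P 0, P 1, P 2]`, `![Q 0, Q 1, Q 2]`), as in the certificate tables. -/
theorem three_slices_of_vector (I P Q : Fin 3 → Fin 5)
    (href :
      ∀ (α : Fin 3 → Fin 5 → ℂ) (W : Fin 3 → (Fin 5 → Fin 5) → ℂ),
        (∀ k, ∀ v v' : Fin 5 → Fin 5, (∀ j, j ≠ I k → v j = v' j) → W k v = W k v') →
        ∀ (u w : Fin 3 → (Fin 5 → Fin 5) → ℂ),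
        (∀ t, ∀ v v' : Fin 5 → Fin 5,
            v ((![P 0, P 1, P 2] : Fin 3 → Fin 5) t) = v' ((![P 0, P 1, P 2] : Fin 3 → Fin 5) t) →
            v ((![Q 0, Q 1, Q 2] : Fin 3 → Fin 5) t) = v' ((![Q 0, Q 1, Q 2] : Fin 3 → Fin 5) t) → u t v = u t v') →
        (∀ t, ∀ v v' : Fin 5 → Fin 5,
            (∀ j, j ≠ (![P 0, P 1, P 2] : Fin 3 → Fin 5) t → j ≠ (![Q 0, Q 1, Q 2] : Fin 3 → Fin 5) t → v j = v' j) → w t v = w t v') →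
        ¬ ∀ v : Fin 5 → Fin 5, (if Function.Injective v then (1 : ℂ) else 0) =
            (∑ k, α k (v (I k)) * W k v) + ∑ t, u t v * w t v)
    (α : Fin 3 → Fin 5 → ℂ) (W : Fin 3 → (Fin 5 → Fin 5) → ℂ)
    (hW : ∀ k, ∀ v v' : Fin 5 → Fin 5, (∀ j, j ≠ I k → v j = v' j) → W k v = W k v')
    (u w : Fin 3 → (Fin 5 → Fin 5) → ℂ)
    (hu : ∀ t, ∀ v v' : Fin 5 → Fin 5,
      v (P t) = v' (P t) → v (Q t) = v' (Q t) → u t v = u t v')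
    (hw : ∀ t, ∀ v v' : Fin 5 → Fin 5,
      (∀ j, j ≠ P t → j ≠ Q t → v j = v' j) → w t v = w t v') :
    ¬ ∀ v : Fin 5 → Fin 5, (if Function.Injective v then (1 : ℂ) else 0) =
        (∑ k, α k (v (I k)) * W k v) + ∑ t, u t v * w t v := by
  have eP : (![P 0, P 1, P 2] : Fin 3 → Fin 5) = P := by
    funext t; fin_cases t <;> rfl
  have eQ : (![Q 0, Q 1, Q 2] : Fin 3 → Fin 5) = Q := by
    funext t; fin_cases t <;> rfl
  rw [eP, eQ] at href
  exact href α W hW u w hu hw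

/-! ### §3 Reduction to the sorted normal forms -/

/-- **Reduction.**  If every SORTED configuration (oriented cuts, codes `5 p + q` non-decreasing, vector form) with
slices at the pattern `I` is refuted, then so is every configuration whose slice slots are carried to `I` by some slot
relabelling `σ` and slice re-indexing `π`. -/
theorem three_slices_reduce (I : Fin 3 → Fin 5)
    (key : ∀ p0 q0 p1 q1 p2 q2 : Fin 5, p0 < q0 → p1 < q1 → p2 < q2 →
      (p0 : ℕ) * 5 + q0 ≤ (p1 : ℕ) * 5 + q1 → (p1 : ℕ) * 5 + q1 ≤ (p2 : ℕ) * 5 + q2 →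
      ∀ (α : Fin 3 → Fin 5 → ℂ) (W : Fin 3 → (Fin 5 → Fin 5) → ℂ),
        (∀ k, ∀ v v' : Fin 5 → Fin 5, (∀ j, j ≠ I k → v j = v' j) → W k v = W k v') →
        ∀ (u w : Fin 3 → (Fin 5 → Fin 5) → ℂ),
        (∀ t, ∀ v v' : Fin 5 → Fin 5,
            v ((![p0, p1, p2] : Fin 3 → Fin 5) t) = v' ((![p0, p1, p2] : Fin 3 → Fin 5) t) →
            v ((![q0, q1, q2] : Fin 3 → Fin 5) t) = v' ((![q0, q1, q2] : Fin 3 → Fin 5) t) → u t v = u t v') →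
        (∀ t, ∀ v v' : Fin 5 → Fin 5,
            (∀ j, j ≠ (![p0, p1, p2] : Fin 3 → Fin 5) t → j ≠ (![q0, q1, q2] : Fin 3 → Fin 5) t → v j = v' j) → w t v = w t v') →
        ¬ ∀ v : Fin 5 → Fin 5, (if Function.Injective v then (1 : ℂ) else 0) =
            (∑ k, α k (v (I k)) * W k v) + ∑ t, u t v * w t v)
    (σ : Equiv.Perm (Fin 5)) (π : Equiv.Perm (Fin 3)) (i : Fin 3 → Fin 5) (hI : ∀ k, σ (i (π k)) = I k)
    (p q : Fin 3 → Fin 5) (hpq : ∀ t, p t ≠ q t)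
    (α : Fin 3 → Fin 5 → ℂ) (W : Fin 3 → (Fin 5 → Fin 5) → ℂ)
    (hW : ∀ k, ∀ v v' : Fin 5 → Fin 5, (∀ j, j ≠ i k → v j = v' j) → W k v = W k v')
    (u w : Fin 3 → (Fin 5 → Fin 5) → ℂ)
    (hu : ∀ t, ∀ v v' : Fin 5 → Fin 5,
      v (p t) = v' (p t) → v (q t) = v' (q t) → u t v = u t v')
    (hw : ∀ t, ∀ v v' : Fin 5 → Fin 5,
      (∀ j, j ≠ p t → j ≠ q t → v j = v' j) → w t v = w t v') :
    ¬ ∀ v : Fin 5 → Fin 5, (if Function.Injective v then (1 : ℂ) else 0) =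
        (∑ k, α k (v (i k)) * W k v) + ∑ t, u t v * w t v := by
  refine three_slices_transport_slots σ π i I hI p q ?_ α W hW u w hu hw
  intro α₁ W₁ hW₁ u₁ w₁ hu₁ hw₁
  refine three_slices_transport_flip I (fun t => σ (p t)) (fun t => σ (q t)) ?_ α₁ W₁ hW₁ u₁ w₁ hu₁ hw₁
  intro α₂ W₂ hW₂ u₂ w₂ hu₂ hw₂
  -- the oriented cuts and their sorting permutation
  set P₁ : Fin 3 → Fin 5 := fun t => min (σ (p t)) (σ (q t)) with hP₁
  set Q₁ : Fin 3 → Fin 5 := fun t => max (σ (p t)) (σ (q t)) with hQ₁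
  have hlt : ∀ t, P₁ t < Q₁ t := fun t => min_lt_max.mpr (fun h => hpq t (σ.injective h))
  obtain ⟨ρ, hρ1, hρ2⟩ := sort_three (fun t => (P₁ t : ℕ) * 5 + Q₁ t)
  refine three_slices_transport_pairs ρ I P₁ Q₁ ?_ α₂ W₂ hW₂ u₂ w₂ hu₂ hw₂
  intro α₃ W₃ hW₃ u₃ w₃ hu₃ hw₃
  refine three_slices_of_vector I (fun t => P₁ (ρ t)) (fun t => Q₁ (ρ t)) ?_ α₃ W₃ hW₃ u₃ w₃ hu₃ hw₃
  exact key (P₁ (ρ 0)) (Q₁ (ρ 0)) (P₁ (ρ 1)) (Q₁ (ρ 1)) (P₁ (ρ 2)) (Q₁ (ρ 2)) (hlt _) (hlt _) (hlt _) hρ1 hρ2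

end LaplaceFiveSlices

end Summit.ValiantsHypothesis.ValiantsHypothesis.Theorems.RigidityForcesSymmetryRankRigidMinimalRepr
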